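import Mathlib
import HarnessLib
import Summits.ValiantsHypothesis.ValiantsHypothesis.Theorems.LacunarySymmetroidMatrixDescartesProductPlusOneCoherentK

/-!
# ValiantsHypothesis / LacunarySymmetroid — crux `MatrixDescartes` (stmt-ValiantsHypothesis-18050, V1),
# LINE (A) «product_plus_one», S4″/S5 Euler currency: the TAME SECTOR FOR EVERY K — calculus (the u-chart certificate)

p7 g14's tame sector (✓ `…TameCalculus` / `…TameSector`, K = 3): no-dip trinomials `a + b u + c u^r` (`a c < 0`, `b` FREE) are log-concave in the
u-chart `u = x^{d_1−d_0}` exactly when the support ratio is `r ≤ 4` (`key_identity`, threshold `(r−1)²(r−4)`).  This file is the every-K version of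
that certificate.  A sparse factor `f = Σ_{i < T+2} c_i X^{d_i}` (`d` strictly increasing) is TAME when `c_0 ≠ 0`, the SECOND coefficient `c_1` is free,
and every higher coefficient is weakly opposite in sign to `c_0` (`c_0 c_i ≤ 0` for `i ≥ 2`); the support is in the TAME WINDOW when
`d_{T+1} − d_0 ≤ 4 (d_1 − d_0)` (the whole support within four times the FIRST gap).  With the u-chart weight `w = d_1 − d_0` and
`Ξ(x) = (X f′ − d_0 f)(x)/(x^w f(x))`:

* `tame_quadratic_identity` — `(Σ A_l u_l)² + 4w²((Σ u_l)(Σ δ_l(δ_l−w)u_l) − (Σ δ_l u_l)²) = Σ_l Σ_{l'} (δ_l−w)(δ_{l'}−w)((δ_l−2w)(δ_{l'}−2w) − 4w²)·u_l u_{l'}`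
  with `A_l = δ_l(δ_l − 3w)` (the every-K form of `key_identity`: in ratio units the pair coefficient is `½(ρ−1)(ρ'−1)((ρ−2)(ρ'−2) − 4)`, the
  diagonal `¼ρ(ρ−1)²(ρ−4)`);
* `tame_pair_coeff_nonpos` — that pair coefficient is `≤ 0` for `w ≤ δ_l, δ_{l'} ≤ 4w`;
* `tame_bracket` — completing the square in the FREE second letter,
  `4w²(f·E − N₀²) = 4w²·u_0·E₂ − (2w²u_1 − A₂)² + [A₂² + 4w²(S₂E₂ − N₂²)]` (`E₂, N₂, A₂, S₂` the sums over the letters `l ≥ 2`), all three parts `≤ 0`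
  for tame data in the window; `< 0` unless the data is the bottom monomial;
* ★ `hasDerivAt_tameXi` — for a tame factor in the tame window and every `x > 0` with `f(x) ≠ 0`: `Ξ` has a derivative `D ≤ 0` at `x`, `D < 0`
  unless `f = c_0 X^{d_0}`.

The counts (`Z₊(eulerNumerator d a 0) ≤ 2m + 1` for every format in the tame window; members; K = 3 rows; top mirror) are drawn in
`…ProductPlusOneTameK` / `…TameKTop`.  Honest framing: calculus of a sector rung of the research stubs; NOT `stub_eulerBoundK3` / `stub_classRowK3` /
`stub_polyLaw` / `MatrixDescartes` / B; `VP ≠ VNP` NOT proved.  No definitions, no named facts.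
-/

set_option linter.dupNamespace false

namespace Summit.ValiantsHypothesis.ValiantsHypothesis.Theorems.LacunarySymmetroidMatrixDescartes

namespace ProductPlusOne

open Polynomial Finset
open scoped BigOperators

/-! ### §A The u-chart certificate for every K -/

/-- **The every-K `key_identity`**: `(Σ A u)² + 4w²((Σ u)(Σ δ(δ−w)u) − (Σ δu)²) = Σ_i Σ_{i'} (δ_i−w)(δ_{i'}−w)((δ_i−2w)(δ_{i'}−2w) − 4w²)·u_i u_{i'}`,
`A_i = δ_i(δ_i − 3w)`. [this file's lemma] -/
theorem tame_quadratic_identity (n : ℕ) (δ u : ℕ → ℝ) (w : ℝ) :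
    (∑ i ∈ range n, δ i * (δ i - 3 * w) * u i) ^ 2
      + 4 * w ^ 2 * ((∑ i ∈ range n, u i) * (∑ i ∈ range n, δ i * (δ i - w) * u i) - (∑ i ∈ range n, δ i * u i) ^ 2)
    = ∑ i ∈ range n, ∑ i' ∈ range n,
        (δ i - w) * (δ i' - w) * ((δ i - 2 * w) * (δ i' - 2 * w) - 4 * w ^ 2) * (u i * u i') := by
  -- the left side as an (unsymmetrised) double sum
  have hL : (∑ i ∈ range n, δ i * (δ i - 3 * w) * u i) ^ 2
      + 4 * w ^ 2 * ((∑ i ∈ range n, u i) * (∑ i ∈ range n, δ i * (δ i - w) * u i) - (∑ i ∈ range n, δ i * u i) ^ 2)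
      = ∑ i ∈ range n, ∑ i' ∈ range n,
          (δ i * (δ i - 3 * w) * (δ i' * (δ i' - 3 * w)) + 4 * w ^ 2 * (δ i' * (δ i' - w)) - 4 * w ^ 2 * (δ i * δ i'))
            * (u i * u i') := by
    rw [sq (∑ i ∈ range n, δ i * (δ i - 3 * w) * u i), sq (∑ i ∈ range n, δ i * u i), Finset.sum_mul_sum, Finset.sum_mul_sum,
      Finset.sum_mul_sum, ← Finset.sum_sub_distrib, Finset.mul_sum, ← Finset.sum_add_distrib]
    refine Finset.sum_congr rfl fun i _ => ?_
    rw [← Finset.sum_sub_distrib, Finset.mul_sum, ← Finset.sum_add_distrib]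
    refine Finset.sum_congr rfl fun i' _ => by ring
  have hsymm : ∑ i ∈ range n, ∑ i' ∈ range n,
        (δ i * (δ i - 3 * w) * (δ i' * (δ i' - 3 * w)) + 4 * w ^ 2 * (δ i' * (δ i' - w)) - 4 * w ^ 2 * (δ i * δ i'))
          * (u i * u i')
      = ∑ i ∈ range n, ∑ i' ∈ range n,
        (δ i' * (δ i' - 3 * w) * (δ i * (δ i - 3 * w)) + 4 * w ^ 2 * (δ i * (δ i - w)) - 4 * w ^ 2 * (δ i' * δ i))
          * (u i * u i') := by
    rw [Finset.sum_comm]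
    refine Finset.sum_congr rfl fun i _ => Finset.sum_congr rfl fun i' _ => by ring
  rw [hL]
  have h2 : ∑ i ∈ range n, ∑ i' ∈ range n,
        (δ i * (δ i - 3 * w) * (δ i' * (δ i' - 3 * w)) + 4 * w ^ 2 * (δ i' * (δ i' - w)) - 4 * w ^ 2 * (δ i * δ i'))
          * (u i * u i')
      + ∑ i ∈ range n, ∑ i' ∈ range n,
        (δ i' * (δ i' - 3 * w) * (δ i * (δ i - 3 * w)) + 4 * w ^ 2 * (δ i * (δ i - w)) - 4 * w ^ 2 * (δ i' * δ i))
          * (u i * u i')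
      = 2 * ∑ i ∈ range n, ∑ i' ∈ range n,
        (δ i - w) * (δ i' - w) * ((δ i - 2 * w) * (δ i' - 2 * w) - 4 * w ^ 2) * (u i * u i') := by
    rw [Finset.mul_sum, ← Finset.sum_add_distrib]
    refine Finset.sum_congr rfl fun i _ => ?_
    rw [Finset.mul_sum, ← Finset.sum_add_distrib]
    refine Finset.sum_congr rfl fun i' _ => by ring
  rw [← hsymm] at h2
  linarith

/-- **The pair coefficient is nonpositive in the tame window**: `(s−w)(t−w)((s−2w)(t−2w) − 4w²) ≤ 0` for `w ≤ s, t ≤ 4w` (`w > 0`). [folklore] -/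
theorem tame_pair_coeff_nonpos (w s t : ℝ) (hw : 0 < w) (hs : w ≤ s) (hs4 : s ≤ 4 * w) (ht : w ≤ t) (ht4 : t ≤ 4 * w) :
    (s - w) * (t - w) * ((s - 2 * w) * (t - 2 * w) - 4 * w ^ 2) ≤ 0 := by
  have h1 : 0 ≤ (s - w) * (t - w) := mul_nonneg (by linarith) (by linarith)
  have h2 : (s - 2 * w) * (t - 2 * w) - 4 * w ^ 2 ≤ 0 := by
    have hs0 : 0 ≤ s := by linarith
    have ht0 : 0 ≤ t := by linarith
    nlinarith [mul_nonneg (sub_nonneg.2 hs4) ht0, mul_nonneg (sub_nonneg.2 ht4) hs0]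
  exact mul_nonpos_of_nonneg_of_nonpos h1 h2

/-- **The tame bracket, bottom letter positive** (data `v_0 > 0`, `v_1` free, `v_i ≤ 0` for `2 ≤ i < T+2`; `δ 0 = 0`, `δ 1 = w > 0`,
`w < δ_i ≤ 4w` for `i ≥ 2`): `S₀·E − N₀² ≤ 0`, and `< 0` unless the data is the bottom monomial. [this file's lemma] -/
theorem tame_bracket_of_pos (T : ℕ) (δ v : ℕ → ℝ) (w : ℝ) (hw : 0 < w) (hδ0 : δ 0 = 0) (hδ1 : δ 1 = w)
    (hδ : ∀ i, 2 ≤ i → i < T + 2 → w < δ i ∧ δ i ≤ 4 * w)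
    (hv0 : 0 < v 0) (hv : ∀ i, 2 ≤ i → i < T + 2 → v i ≤ 0) :
    (∑ i ∈ range (T + 2), v i) * (∑ i ∈ range (T + 2), δ i * (δ i - w) * v i)
        - (∑ i ∈ range (T + 2), δ i * v i) ^ 2 ≤ 0 ∧
    ((∃ i, 1 ≤ i ∧ i < T + 2 ∧ v i ≠ 0) →
      (∑ i ∈ range (T + 2), v i) * (∑ i ∈ range (T + 2), δ i * (δ i - w) * v i)
        - (∑ i ∈ range (T + 2), δ i * v i) ^ 2 < 0) := by
  -- peel off the two bottom letters
  have hpeel : ∀ F : ℕ → ℝ, ∑ i ∈ range (T + 2), F i = F 0 + F 1 + ∑ i ∈ range T, F (i + 2) := by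
    intro F
    rw [Finset.sum_range_succ', Finset.sum_range_succ']
    ring
  set S₂ := ∑ i ∈ range T, v (i + 2) with hS₂
  set E₂ := ∑ i ∈ range T, δ (i + 2) * (δ (i + 2) - w) * v (i + 2) with hE₂
  set N₂ := ∑ i ∈ range T, δ (i + 2) * v (i + 2) with hN₂
  set A₂ := ∑ i ∈ range T, δ (i + 2) * (δ (i + 2) - 3 * w) * v (i + 2) with hA₂
  have e1 : ∑ i ∈ range (T + 2), v i = v 0 + v 1 + S₂ := hpeel v
  have e2 : ∑ i ∈ range (T + 2), δ i * (δ i - w) * v i = E₂ := by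
    rw [hpeel (fun i => δ i * (δ i - w) * v i)]; simp only [hδ0, hδ1]; ring
  have e3 : ∑ i ∈ range (T + 2), δ i * v i = w * v 1 + N₂ := by
    rw [hpeel (fun i => δ i * v i)]; simp only [hδ0, hδ1]; ring
  have eA : A₂ = E₂ - 2 * w * N₂ := by
    rw [hA₂, hE₂, hN₂, Finset.mul_sum, ← Finset.sum_sub_distrib]
    exact Finset.sum_congr rfl fun i _ => by ring
  -- the quadratic identity over the upper letters and its sign
  have hQ := tame_quadratic_identity T (fun i => δ (i + 2)) (fun i => v (i + 2)) w
  have hQle : A₂ ^ 2 + 4 * w ^ 2 * (S₂ * E₂ - N₂ ^ 2) ≤ 0 := by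
    rw [hA₂, hS₂, hE₂, hN₂, hQ]
    refine Finset.sum_nonpos fun i hi => Finset.sum_nonpos fun i' hi' => ?_
    rw [Finset.mem_range] at hi hi'
    have hdi := hδ (i + 2) (by omega) (by omega)
    have hdi' := hδ (i' + 2) (by omega) (by omega)
    have hc := tame_pair_coeff_nonpos w (δ (i + 2)) (δ (i' + 2)) hw hdi.1.le hdi.2 hdi'.1.le hdi'.2
    have huu : 0 ≤ v (i + 2) * v (i' + 2) :=
      mul_nonneg_of_nonpos_of_nonpos (hv _ (by omega) (by omega)) (hv _ (by omega) (by omega))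
    exact mul_nonpos_of_nonpos_of_nonneg hc huu
  -- `E₂ ≤ 0`
  have hEterm : ∀ i ∈ range T, δ (i + 2) * (δ (i + 2) - w) * v (i + 2) ≤ 0 := by
    intro i hi
    rw [Finset.mem_range] at hi
    have hdi := hδ (i + 2) (by omega) (by omega)
    have : 0 < δ (i + 2) * (δ (i + 2) - w) := by nlinarith
    exact mul_nonpos_of_nonneg_of_nonpos this.le (hv _ (by omega) (by omega))
  have hE₂le : E₂ ≤ 0 := Finset.sum_nonpos hEterm
  -- the completed square
  have hid : 4 * w ^ 2 * ((v 0 + v 1 + S₂) * E₂ - (w * v 1 + N₂) ^ 2)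
      = -(2 * w ^ 2 * v 1 - A₂) ^ 2 + 4 * w ^ 2 * (v 0 * E₂) + (A₂ ^ 2 + 4 * w ^ 2 * (S₂ * E₂ - N₂ ^ 2)) := by
    rw [eA]; ring
  have hw2 : 0 < 4 * w ^ 2 := by positivity
  have h0E : v 0 * E₂ ≤ 0 := mul_nonpos_of_nonneg_of_nonpos hv0.le hE₂le
  have h0E4 : 4 * w ^ 2 * (v 0 * E₂) ≤ 0 := mul_nonpos_of_nonneg_of_nonpos hw2.le h0E
  have hsqnn : 0 ≤ (2 * w ^ 2 * v 1 - A₂) ^ 2 := sq_nonneg _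
  rw [e1, e2, e3]
  set Bk := (v 0 + v 1 + S₂) * E₂ - (w * v 1 + N₂) ^ 2 with hBk
  constructor
  · have h1 : 4 * w ^ 2 * Bk ≤ 0 := by rw [hid]; linarith
    by_contra hcon
    push Not at hcon
    exact absurd h1 (not_le.2 (mul_pos hw2 hcon))
  · rintro ⟨i₀, hi₀1, hi₀T, hvi₀⟩
    by_cases hup : ∃ i, 2 ≤ i ∧ i < T + 2 ∧ v i ≠ 0
    · -- an upper letter is present: `v 0 · E₂ < 0`
      obtain ⟨i₁, hi₁2, hi₁T, hvi₁⟩ := hup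
      have hv1 : v i₁ < 0 := lt_of_le_of_ne (hv i₁ hi₁2 hi₁T) hvi₁
      obtain ⟨k, rfl⟩ : ∃ k, i₁ = k + 2 := ⟨i₁ - 2, by omega⟩
      have hmem : k ∈ range T := Finset.mem_range.2 (by omega)
      have hdk := hδ (k + 2) (by omega) (by omega)
      have hlt : δ (k + 2) * (δ (k + 2) - w) * v (k + 2) < 0 := by
        have : 0 < δ (k + 2) * (δ (k + 2) - w) := by nlinarith
        exact mul_neg_of_pos_of_neg this hv1
      have hE₂lt : E₂ < 0 := by
        have hle : E₂ = ∑ i ∈ (range T).erase k, δ (i + 2) * (δ (i + 2) - w) * v (i + 2)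
            + δ (k + 2) * (δ (k + 2) - w) * v (k + 2) := by
          rw [hE₂, Finset.sum_erase_add _ _ hmem]
        have hrest : ∑ i ∈ (range T).erase k, δ (i + 2) * (δ (i + 2) - w) * v (i + 2) ≤ 0 :=
          Finset.sum_nonpos fun i hi => hEterm i (Finset.mem_of_mem_erase hi)
        linarith
      have h0E' : v 0 * E₂ < 0 := mul_neg_of_pos_of_neg hv0 hE₂lt
      have h0E4' : 4 * w ^ 2 * (v 0 * E₂) < 0 := mul_neg_of_pos_of_neg hw2 h0E'
      have h1 : 4 * w ^ 2 * Bk < 0 := by rw [hid]; linarith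
      by_contra hcon
      push Not at hcon
      exact absurd h1 (not_lt.2 (mul_nonneg hw2.le hcon))
    · -- no upper letter: the data is `v 0`, `v 1` with `v 1 ≠ 0`
      push Not at hup
      have hi₀ : i₀ = 1 := by
        by_contra hne
        exact hvi₀ (hup i₀ (by omega) hi₀T)
      have hv1 : v 1 ≠ 0 := hi₀ ▸ hvi₀
      have hzero : ∀ i ∈ range T, v (i + 2) = 0 :=
        fun i hi => hup (i + 2) (by omega) (by have := Finset.mem_range.1 hi; omega)
      have hS : S₂ = 0 := Finset.sum_eq_zero fun i hi => hzero i hi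
      have hE : E₂ = 0 := Finset.sum_eq_zero fun i hi => by rw [hzero i hi, mul_zero]
      have hN : N₂ = 0 := Finset.sum_eq_zero fun i hi => by rw [hzero i hi, mul_zero]
      have hsq : 0 < (w * v 1) ^ 2 := by positivity
      have : Bk = -(w * v 1) ^ 2 := by rw [hBk, hS, hE, hN]; ring
      rw [this]; linarith

/-- **The tame bracket** (either sign of the bottom letter; reduction `v ↦ −v`). [this file's lemma] -/
theorem tame_bracket (T : ℕ) (δ u : ℕ → ℝ) (w : ℝ) (hw : 0 < w) (hδ0 : δ 0 = 0) (hδ1 : δ 1 = w)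
    (hδ : ∀ i, 2 ≤ i → i < T + 2 → w < δ i ∧ δ i ≤ 4 * w)
    (hu : (0 < u 0 ∧ ∀ i, 2 ≤ i → i < T + 2 → u i ≤ 0) ∨ (u 0 < 0 ∧ ∀ i, 2 ≤ i → i < T + 2 → 0 ≤ u i)) :
    (∑ i ∈ range (T + 2), u i) * (∑ i ∈ range (T + 2), δ i * (δ i - w) * u i)
        - (∑ i ∈ range (T + 2), δ i * u i) ^ 2 ≤ 0 ∧
    ((∃ i, 1 ≤ i ∧ i < T + 2 ∧ u i ≠ 0) →
      (∑ i ∈ range (T + 2), u i) * (∑ i ∈ range (T + 2), δ i * (δ i - w) * u i)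
        - (∑ i ∈ range (T + 2), δ i * u i) ^ 2 < 0) := by
  rcases hu with hu | hu
  · exact tame_bracket_of_pos T δ u w hw hδ0 hδ1 hδ hu.1 hu.2
  · have h := tame_bracket_of_pos T δ (fun i => -u i) w hw hδ0 hδ1 hδ (neg_pos.mpr hu.1)
      (fun i hi hiT => neg_nonpos.mpr (hu.2 i hi hiT))
    have e1 : (∑ i ∈ range (T + 2), -u i) = -∑ i ∈ range (T + 2), u i := Finset.sum_neg_distrib ..
    have e2 : (∑ i ∈ range (T + 2), δ i * (δ i - w) * -u i) = -∑ i ∈ range (T + 2), δ i * (δ i - w) * u i := by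
      rw [← Finset.sum_neg_distrib]; exact Finset.sum_congr rfl fun i _ => by ring
    have e3 : (∑ i ∈ range (T + 2), δ i * -u i) = -∑ i ∈ range (T + 2), δ i * u i := by
      rw [← Finset.sum_neg_distrib]; exact Finset.sum_congr rfl fun i _ => by ring
    simp only [e1, e2, e3, neg_mul_neg, neg_sq] at h
    exact ⟨h.1, fun ⟨i, hi1, hiT, hui⟩ => h.2 ⟨i, hi1, hiT, neg_ne_zero.mpr hui⟩⟩

/-! ### §B The derivative of `Ξ = (X f′ − d₀ f)/(x^w f)`, `w = d_1 − d_0`, is nonpositive for a tame factor in the tame window -/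

/-- ★ For a TAME sparse factor `f = Σ_{i < T+2} c_i X^{d_i}` (`d` strictly increasing, `c_0 ≠ 0`, `c_1` free, `c_0 c_i ≤ 0` for `i ≥ 2`) in the
tame window `d_{T+1} − d_0 ≤ 4(d_1 − d_0)`, and the u-chart weight `w = d_1 − d_0`: at every `x > 0` with `f(x) ≠ 0`,
`Ξ(y) = (X f′ − d_0 f)(y)/(y^w f(y))` has a NONPOSITIVE derivative, NEGATIVE unless `f = c_0 X^{d_0}`. [this file's theorem] -/
theorem hasDerivAt_tameXi (T : ℕ) (d : ℕ → ℕ) (hd : StrictMono d) (hwin : d (T + 1) - d 0 ≤ 4 * (d 1 - d 0)) (c : ℕ → ℝ)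
    (ht : (0 < c 0 ∧ ∀ i, 2 ≤ i → i < T + 2 → c i ≤ 0) ∨ (c 0 < 0 ∧ ∀ i, 2 ≤ i → i < T + 2 → 0 ≤ c i)) {x : ℝ} (hx : 0 < x)
    (hf : (∑ i ∈ Finset.range (T + 2), C (c i) * X ^ (d i) : ℝ[X]).eval x ≠ 0) :
    ∃ D : ℝ, D ≤ 0 ∧ ((∃ i, 1 ≤ i ∧ i < T + 2 ∧ c i ≠ 0) → D < 0) ∧ HasDerivAt (fun y : ℝ =>
      (X * derivative (∑ i ∈ Finset.range (T + 2), C (c i) * X ^ (d i) : ℝ[X])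
          - C ((d 0 : ℕ) : ℝ) * ∑ i ∈ Finset.range (T + 2), C (c i) * X ^ (d i)).eval y
        / (y ^ (d 1 - d 0) * (∑ i ∈ Finset.range (T + 2), C (c i) * X ^ (d i) : ℝ[X]).eval y)) D x := by
  classical
  set f : ℝ[X] := ∑ i ∈ Finset.range (T + 2), C (c i) * X ^ (d i) with hfdef
  set N₀ : ℝ[X] := X * derivative f - C ((d 0 : ℕ) : ℝ) * f with hN₀
  set w : ℕ := d 1 - d 0 with hw
  have hd01 : d 0 < d 1 := hd (by omega)
  have hwR : (w : ℝ) = (d 1 : ℝ) - d 0 := by rw [hw, Nat.cast_sub hd01.le]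
  have hwpos : (0 : ℝ) < w := by
    have := (Nat.cast_lt.2 hd01 : ((d 0 : ℕ) : ℝ) < _)
    rw [hwR]; linarith
  have hV : x ^ w * f.eval x ≠ 0 := mul_ne_zero (pow_ne_zero _ hx.ne') hf
  have hnum : HasDerivAt (fun y : ℝ => N₀.eval y) ((derivative N₀).eval x) x := N₀.hasDerivAt x
  have hden : HasDerivAt (fun y : ℝ => y ^ w * f.eval y) (((w : ℕ) : ℝ) * x ^ (w - 1) * f.eval x + x ^ w * (derivative f).eval x) x :=
    (hasDerivAt_pow w x).mul (f.hasDerivAt x)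
  -- sparse forms
  have hN₀s : N₀ = ∑ i ∈ Finset.range (T + 2), C (c i * ((d i : ℝ) - d 0)) * X ^ (d i) := by
    rw [hN₀, hfdef]; exact euler_sparse (T + 2) d c _
  have hEs : X * derivative N₀ - C (((w : ℕ) : ℝ) + d 0) * N₀
      = ∑ i ∈ Finset.range (T + 2), C (c i * ((d i : ℝ) - d 0) * ((d i : ℝ) - ((w : ℝ) + d 0))) * X ^ (d i) := by
    rw [hN₀s]; exact euler_sparse (T + 2) d (fun i => c i * ((d i : ℝ) - d 0)) _
  have hXf : x * (derivative f).eval x = N₀.eval x + (d 0 : ℝ) * f.eval x := by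
    simp only [hN₀, eval_sub, eval_mul, eval_C, eval_X]; ring
  have evf : f.eval x = ∑ i ∈ Finset.range (T + 2), c i * x ^ (d i) := by
    rw [hfdef]; simp only [eval_finsetSum, eval_mul, eval_C, eval_pow, eval_X]
  have evN : N₀.eval x = ∑ i ∈ Finset.range (T + 2), ((d i : ℝ) - d 0) * (c i * x ^ (d i)) := by
    rw [hN₀s]; simp only [eval_finsetSum, eval_mul, eval_C, eval_pow, eval_X]
    exact Finset.sum_congr rfl fun i _ => by ring
  have evE : (X * derivative N₀ - C (((w : ℕ) : ℝ) + d 0) * N₀).eval x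
      = ∑ i ∈ Finset.range (T + 2), ((d i : ℝ) - d 0) * (((d i : ℝ) - d 0) - w) * (c i * x ^ (d i)) := by
    rw [hEs]; simp only [eval_finsetSum, eval_mul, eval_C, eval_pow, eval_X]
    exact Finset.sum_congr rfl fun i _ => by ring
  have evE' : (X * derivative N₀ - C (((w : ℕ) : ℝ) + d 0) * N₀).eval x
      = x * (derivative N₀).eval x - ((w : ℝ) + d 0) * N₀.eval x := by
    simp only [eval_sub, eval_mul, eval_C, eval_X]
  -- `x · numerator = x^w · (f·E − N₀²)`
  have hkx : x * (((w : ℕ) : ℝ) * x ^ (w - 1)) = (w : ℝ) * x ^ w := by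
    rcases Nat.eq_zero_or_pos w with h0 | hpos
    · rw [h0]; simp
    · rw [← Nat.sub_add_cancel hpos]; simp [pow_succ]; ring
  have hid : x * ((derivative N₀).eval x * (x ^ w * f.eval x)
        - N₀.eval x * (((w : ℕ) : ℝ) * x ^ (w - 1) * f.eval x + x ^ w * (derivative f).eval x))
      = x ^ w * (f.eval x * (X * derivative N₀ - C (((w : ℕ) : ℝ) + d 0) * N₀).eval x - (N₀.eval x) ^ 2) := by
    rw [evE']
    linear_combination (-(N₀.eval x) * f.eval x) * hkx + (-(N₀.eval x) * x ^ w) * hXf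
  -- the bracket is the tame form
  have hwinR : ((d (T + 1) : ℝ) - d 0) ≤ 4 * (w : ℝ) := by
    have h1 : d 0 ≤ d (T + 1) := hd.monotone (by omega)
    have h2 : ((d (T + 1) - d 0 : ℕ) : ℝ) ≤ ((4 * (d 1 - d 0) : ℕ) : ℝ) := by exact_mod_cast hwin
    rw [Nat.cast_sub h1, Nat.cast_mul, Nat.cast_sub hd01.le] at h2
    rw [hwR]; push_cast at h2; linarith
  have hbr := tame_bracket T (fun i => (d i : ℝ) - d 0) (fun i => c i * x ^ (d i)) (w : ℝ) hwpos (by simp)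
    (by simp [hwR])
    (by
      intro i hi2 hiT
      constructor
      · have hlt : d 1 < d i := hd (by omega)
        have := (Nat.cast_lt.2 hlt : ((d 1 : ℕ) : ℝ) < _)
        rw [hwR]; linarith
      · have hle : d i ≤ d (T + 1) := hd.monotone (by omega)
        have := (Nat.cast_le.2 hle : ((d i : ℕ) : ℝ) ≤ _)
        linarith)
    (by
      rcases ht with ⟨h0, h⟩ | ⟨h0, h⟩
      · exact Or.inl ⟨mul_pos h0 (pow_pos hx _), fun i hi hiT => mul_nonpos_of_nonpos_of_nonneg (h i hi hiT) (pow_pos hx _).le⟩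
      · exact Or.inr ⟨mul_neg_of_neg_of_pos h0 (pow_pos hx _), fun i hi hiT => mul_nonneg (h i hi hiT) (pow_pos hx _).le⟩)
  have hbr' : f.eval x * (X * derivative N₀ - C (((w : ℕ) : ℝ) + d 0) * N₀).eval x - (N₀.eval x) ^ 2
      = (∑ i ∈ range (T + 2), c i * x ^ (d i)) * (∑ i ∈ range (T + 2), ((d i : ℝ) - d 0) * (((d i : ℝ) - d 0) - w) * (c i * x ^ (d i)))
        - (∑ i ∈ range (T + 2), ((d i : ℝ) - d 0) * (c i * x ^ (d i))) ^ 2 := by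
    rw [evf, evN, evE]
  have hxw : 0 < x ^ w := pow_pos hx _
  set num := (derivative N₀).eval x * (x ^ w * f.eval x)
        - N₀.eval x * (((w : ℕ) : ℝ) * x ^ (w - 1) * f.eval x + x ^ w * (derivative f).eval x) with hnumdef
  have hnum_le : num ≤ 0 := by
    have h1 : x * num ≤ 0 := by
      rw [hid, hbr']; exact mul_nonpos_of_nonneg_of_nonpos hxw.le hbr.1
    by_contra hcon
    push Not at hcon
    exact absurd h1 (not_le.2 (mul_pos hx hcon))
  have hnum_lt : (∃ i, 1 ≤ i ∧ i < T + 2 ∧ c i ≠ 0) → num < 0 := by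
    rintro ⟨i, hi1, hiT, hci⟩
    have hstrict := hbr.2 ⟨i, hi1, hiT, mul_ne_zero hci (pow_ne_zero _ hx.ne')⟩
    have h1 : x * num < 0 := by
      rw [hid, hbr']; exact mul_neg_of_pos_of_neg hxw hstrict
    by_contra hcon
    push Not at hcon
    exact absurd h1 (not_lt.2 (mul_nonneg hx.le hcon))
  have hsq : 0 < (x ^ w * f.eval x) ^ 2 := by positivity
  refine ⟨num / (x ^ w * f.eval x) ^ 2, div_nonpos_of_nonpos_of_nonneg hnum_le hsq.le,
    fun h => div_neg_of_neg_of_pos (hnum_lt h) hsq, ?_⟩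
  exact hnum.div hden hV

end ProductPlusOne

end Summit.ValiantsHypothesis.ValiantsHypothesis.Theorems.LacunarySymmetroidMatrixDescartes
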